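import Literature.Geometry.DiscreteGeometry.ThreePointBoundGeneral
import Summits.Ventures.PackingBounds.SphericalCodes.ThreePointTight
import Summits.Ventures.PackingBounds.SphericalCodes.GhostTwoDistance
import Summits.Ventures.PackingBounds.SphericalCodes.TightFrameOfDesign
import Summits.Ventures.PackingBounds.SphericalCodes.TenTenth

/-!
# Integer-valued three-point certificates with a two-atom slack ⇒ the bound minus one (parametric master implication)

Framing: lottery ticket; floor = certified bounds/negative ranges. Venture `PackingBounds` (cell
`pub-packcert`, recognition seat, T5.md §8–§9).

Parametric form of `TenTenth.card_le_26_of_tight_certificate`, covering every 'SDP-level ghost' cell of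
T5.md §8 ((10,1/10) 27, (30,1/15) 112, (35,1/21) 100, (56,1/56) 121, (64,1/40) 156, (68,3/68) 325,
(81,1/27) 338, (84,1/36) 245, (86,1/26) 430, (112,1/56) 275, (125,1/50) 343). In dimension `m`, for the
angle `s` and an abstract Bachoc–Vallentin certificate (hypotheses-form of
`Literature.….BachocVallentin.card_le_of_threePoint`) with two-point part
`A = A' + a₁ u + a₂ (m u² − 1)`, `a₁, a₂ > 0`, whose bound is EXACTLY the natural number `N` and whose
univariate slack vanishes on `[-1, s]` only at `u ∈ {s, b}` (`N ≥ 1`): if `1 + (N−1) b ≠ 0` and the forced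
exclusive-neighbour count `q* = ((N/m)(2 − 2s) − 2(1 − s)²)/(s − b)²` is not an even natural number, then
every code in `ℝᵐ` with inner products `≤ s` has FEWER than `N` points
(`card_lt_of_tight_twoAtom_certificate`). Chain: `card_le_of_threePoint` (≤ N) → equality would give
`tight_slack_eq_zero` → inner products in `{s, b}`, centred (`pairSum_id_eq_norm_sq`), second moment
`N²/m` (`pairSum_sq_ge`) → tight frame (`sum_sq_inner_eq_of_pairSum_sq_eq`) →
`no_twoDistance_tightFrame_config` (parity) → contradiction.

What remains outside the kernel per cell: the certificate (`A' , a₁, a₂, F, b`'s with `h1, h2, hbound,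
hzero`), currently verified by exact rational arithmetic outside Lean (certs/t5).
-/

noncomputable section

open Finset
open scoped RealInnerProductSpace BigOperators

namespace Summit.Ventures.PackingBounds.SphericalCodes

open Literature.Geometry.DiscreteGeometry

/-- **Parametric master implication.** See the module docstring. Conclusion: `C.card < N`. -/
theorem card_lt_of_tight_twoAtom_certificate {m : ℕ} (hm : 0 < m) (s b : ℝ) (hsb : s ≠ b) (N : ℕ)
    (hN : 1 ≤ N)
    (A' : ℝ → ℝ) (a₁ a₂ : ℝ) (ha₁ : 0 < a₁) (ha₂ : 0 < a₂)
    (F : ℝ → ℝ → ℝ → ℝ) (b11 b12 b22 : ℝ)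
    (hA' : ∀ D : Finset (EuclideanSpace ℝ (Fin m)), (∀ x ∈ D, ‖x‖ = 1) → 0 ≤ BachocVallentin.pairSum D A')
    (hF : ∀ D : Finset (EuclideanSpace ℝ (Fin m)), (∀ x ∈ D, ‖x‖ = 1) → 0 ≤ BachocVallentin.tripleSum D F)
    (hF12 : ∀ u v t, F u v t = F v u t) (hF23 : ∀ u v t, F u v t = F u t v)
    (hb : ∀ l : ℝ, 0 ≤ b11 + 2 * b12 * l + b22 * l ^ 2)
    (h1 : ∀ u : ℝ, -1 ≤ u → u ≤ s →
      (A' u + a₁ * u + a₂ * ((m : ℝ) * u ^ 2 - 1)) + 3 * F u u 1 ≤ -1 - 2 * b12 - b22)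
    (h2 : ∀ u v t : ℝ, -1 ≤ u → u ≤ s → -1 ≤ v → v ≤ s → -1 ≤ t → t ≤ s →
      0 ≤ 1 + 2 * u * v * t - u ^ 2 - v ^ 2 - t ^ 2 → F u v t ≤ -b22)
    (hbound : 1 + (A' 1 + a₁ * 1 + a₂ * ((m : ℝ) * 1 ^ 2 - 1)) + b11 + F 1 1 1 = (N : ℝ))
    (hzero : ∀ u : ℝ, -1 ≤ u → u ≤ s →
      (A' u + a₁ * u + a₂ * ((m : ℝ) * u ^ 2 - 1)) + 3 * F u u 1 = -1 - 2 * b12 - b22 → u = s ∨ u = b)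
    (hNb : 1 + ((N : ℝ) - 1) * b ≠ 0)
    (hq : ∀ q : ℕ, (s - b) ^ 2 * (2 * (q : ℝ)) ≠ (N : ℝ) / m * (2 - 2 * s) - 2 * (1 - s) ^ 2)
    (C : Finset (EuclideanSpace ℝ (Fin m))) (hC : ∀ x ∈ C, ‖x‖ = 1)
    (hcode : ∀ x ∈ C, ∀ y ∈ C, x ≠ y → inner ℝ x y ≤ s) : C.card < N := by
  classical
  set A : ℝ → ℝ := fun u => A' u + a₁ * u + a₂ * ((m : ℝ) * u ^ 2 - 1) with hAdef
  have hmr : (0 : ℝ) < m := by exact_mod_cast hm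
  have hdim : Module.finrank ℝ (EuclideanSpace ℝ (Fin m)) = m := finrank_euclideanSpace_fin
  have hn : 0 < Module.finrank ℝ (EuclideanSpace ℝ (Fin m)) := by rw [hdim]; exact hm
  -- two-point sums of the three parts
  have hPid : BachocVallentin.pairSum C (fun u => u) = ‖∑ x ∈ C, x‖ ^ 2 := pairSum_id_eq_norm_sq C
  have hP2 : BachocVallentin.pairSum C (fun u => (m : ℝ) * u ^ 2 - 1)
      = (m : ℝ) * (∑ x ∈ C, ∑ y ∈ C, (inner ℝ x y) ^ 2) - (C.card : ℝ) ^ 2 := by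
    unfold BachocVallentin.pairSum
    simp only [Finset.sum_sub_distrib, Finset.sum_const, nsmul_eq_mul, mul_one, ← Finset.mul_sum]
    ring
  have hmom := pairSum_sq_ge C hC hn
  rw [hdim] at hmom
  have hP2nonneg : 0 ≤ BachocVallentin.pairSum C (fun u => (m : ℝ) * u ^ 2 - 1) := by
    rw [hP2]
    have : (C.card : ℝ) ^ 2 / (m : ℝ) * m ≤ (∑ x ∈ C, ∑ y ∈ C, (inner ℝ x y) ^ 2) * m :=
      mul_le_mul_of_nonneg_right hmom hmr.le
    rw [div_mul_cancel₀ _ hmr.ne'] at this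
    linarith
  have hsplit : BachocVallentin.pairSum C A = BachocVallentin.pairSum C A'
      + a₁ * BachocVallentin.pairSum C (fun u => u)
      + a₂ * BachocVallentin.pairSum C (fun u => (m : ℝ) * u ^ 2 - 1) := by
    unfold BachocVallentin.pairSum
    simp only [hAdef, Finset.sum_add_distrib, Finset.mul_sum]
  have hid0 : 0 ≤ BachocVallentin.pairSum C (fun u => u) := by rw [hPid]; positivity
  have hA : 0 ≤ BachocVallentin.pairSum C A := by
    rw [hsplit]; have := hA' C hC; positivity
  -- the bound: card ≤ N
  have hAone : 1 + A 1 + b11 + F 1 1 1 = (N : ℝ) := by simp only [hAdef]; linarith [hbound]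
  have hle : (C.card : ℝ) ≤ 1 + A 1 + b11 + F 1 1 1 :=
    BachocVallentin.card_le_of_threePoint s C hC hcode A F b11 b12 b22 hA (hF C hC) hF12 hF23 hb
      (fun u hu hu' => by simp only [hAdef]; exact h1 u hu hu')
      h2 (by rw [hAone]; positivity)
  rw [hAone] at hle
  have hleN : C.card ≤ N := by exact_mod_cast hle
  -- equality is impossible
  rcases lt_or_eq_of_le hleN with hlt | hcard
  · exact hlt
  exfalso
  have htight : (C.card : ℝ) = 1 + A 1 + b11 + F 1 1 1 := by rw [hAone, hcard]
  obtain ⟨hslack, hA0, -⟩ := tight_slack_eq_zero s C hC hcode A F b11 b12 b22 hA (hF C hC)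
    hF12 hF23 hb (fun u hu hu' => by simp only [hAdef]; exact h1 u hu hu') h2 htight
  -- (1) inner products of distinct points are s or b
  have hval : ∀ x ∈ C, ∀ y ∈ C, x ≠ y → inner ℝ x y = s ∨ inner ℝ x y = b := by
    intro x hx y hy hxy
    have hs := hslack x hx y hy hxy
    have hlo : -1 ≤ inner ℝ x y := by
      have h := abs_real_inner_le_norm x y
      rw [hC x hx, hC y hy, mul_one] at h
      exact (abs_le.1 h).1
    refine hzero _ hlo (hcode x hx y hy hxy) ?_
    simp only [hAdef] at hs
    linarith
  -- (2) centred and second moment N²/m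
  rw [hsplit] at hA0
  have hA'0 := hA' C hC
  have hidz : BachocVallentin.pairSum C (fun u => u) = 0 := by
    by_contra hne
    have hpos : 0 < BachocVallentin.pairSum C (fun u => u) := lt_of_le_of_ne hid0 (Ne.symm hne)
    have := mul_pos ha₁ hpos
    have := mul_nonneg ha₂.le hP2nonneg
    linarith
  have hP2z : BachocVallentin.pairSum C (fun u => (m : ℝ) * u ^ 2 - 1) = 0 := by
    by_contra hne
    have hpos : 0 < BachocVallentin.pairSum C (fun u => (m : ℝ) * u ^ 2 - 1) :=
      lt_of_le_of_ne hP2nonneg (Ne.symm hne)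
    have := mul_pos ha₂ hpos
    have := mul_nonneg ha₁.le hid0
    linarith
  have hsum0 : ∑ x ∈ C, x = 0 := by
    rw [hPid] at hidz
    exact norm_eq_zero.1 (pow_eq_zero_iff (n := 2) (by norm_num) |>.1 hidz)
  have hcent : ∀ y ∈ C, ∑ x ∈ C, inner ℝ x y = 0 := by
    intro y _
    rw [← sum_inner, hsum0, inner_zero_left]
  have hsq : ∑ x ∈ C, ∑ y ∈ C, (inner ℝ x y) ^ 2
      = (C.card : ℝ) ^ 2 / Module.finrank ℝ (EuclideanSpace ℝ (Fin m)) := by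
    rw [hP2] at hP2z; rw [hdim]
    field_simp
    linarith
  have hframe : ∀ v : EuclideanSpace ℝ (Fin m), ∑ x ∈ C, (inner ℝ x v) ^ 2 = ((N : ℝ) / m) * ‖v‖ ^ 2 := by
    intro v
    have h := sum_sq_inner_eq_of_pairSum_sq_eq C hC hn hsq v
    rw [hdim, hcard] at h
    exact h
  have hne : C.Nonempty := by
    rw [← Finset.card_pos, hcard]; exact hN
  have hb' : 1 + ((C.card : ℝ) - 1) * b ≠ 0 := by rw [hcard]; exact hNb
  exact no_twoDistance_tightFrame_config C s b ((N : ℝ) / m) hsb hC hval hcent hframe hb' hne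
    (fun q hq' => hq q hq')

/-- The ghost cell with `N = 325`, `s = 3 / 68`, `b = -1 / 4`, frame constant `c = 325 / 68` (forced exclusive-neighbour
count `q* = 169/2`, not an even integer): no centred tight-frame two-distance configuration (T5.md §8 (f)). -/
theorem no_ghost_config_68_3_68 {E : Type*} [NormedAddCommGroup E] [InnerProductSpace ℝ E] [DecidableEq E]
    (C : Finset E) (hcard : C.card = 325) (hC : ∀ x ∈ C, ‖x‖ = 1)
    (hval : ∀ x ∈ C, ∀ y ∈ C, x ≠ y → inner ℝ x y = (3 / 68 : ℝ) ∨ inner ℝ x y = (-1 / 4 : ℝ))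
    (hcent : ∀ y ∈ C, ∑ x ∈ C, inner ℝ x y = 0)
    (hframe : ∀ v : E, ∑ x ∈ C, (inner ℝ x v) ^ 2 = (325 / 68 : ℝ) * ‖v‖ ^ 2) : False := by
  refine no_twoDistance_tightFrame_config C (3 / 68) (-1 / 4) (325 / 68) (by norm_num) hC hval hcent hframe
    (by rw [hcard]; norm_num) (by rw [← Finset.card_pos, hcard]; norm_num) ?_
  intro m h
  have h2 : (4 * m : ℝ) = 169 := by nlinarith [h]
  have h3 : (4 * m : ℕ) = 169 := by exact_mod_cast h2
  omega

/-- The ghost cell with `N = 338`, `s = 1 / 27`, `b = -5 / 21`, frame constant `c = 338 / 81` (forced exclusive-neighbour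
count `q* = 245/3`, not an even integer): no centred tight-frame two-distance configuration (T5.md §8 (f)). -/
theorem no_ghost_config_81_27th {E : Type*} [NormedAddCommGroup E] [InnerProductSpace ℝ E] [DecidableEq E]
    (C : Finset E) (hcard : C.card = 338) (hC : ∀ x ∈ C, ‖x‖ = 1)
    (hval : ∀ x ∈ C, ∀ y ∈ C, x ≠ y → inner ℝ x y = (1 / 27 : ℝ) ∨ inner ℝ x y = (-5 / 21 : ℝ))
    (hcent : ∀ y ∈ C, ∑ x ∈ C, inner ℝ x y = 0)
    (hframe : ∀ v : E, ∑ x ∈ C, (inner ℝ x v) ^ 2 = (338 / 81 : ℝ) * ‖v‖ ^ 2) : False := by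
  refine no_twoDistance_tightFrame_config C (1 / 27) (-5 / 21) (338 / 81) (by norm_num) hC hval hcent hframe
    (by rw [hcard]; norm_num) (by rw [← Finset.card_pos, hcard]; norm_num) ?_
  intro m h
  have h2 : (6 * m : ℝ) = 245 := by nlinarith [h]
  have h3 : (6 * m : ℕ) = 245 := by exact_mod_cast h2
  omega

/-- The ghost cell with `N = 245`, `s = 1 / 36`, `b = -1 / 4`, frame constant `c = 35 / 12` (forced exclusive-neighbour
count `q* = 49`, not an even integer): no centred tight-frame two-distance configuration (T5.md §8 (f)). -/
theorem no_ghost_config_84_36th {E : Type*} [NormedAddCommGroup E] [InnerProductSpace ℝ E] [DecidableEq E]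
    (C : Finset E) (hcard : C.card = 245) (hC : ∀ x ∈ C, ‖x‖ = 1)
    (hval : ∀ x ∈ C, ∀ y ∈ C, x ≠ y → inner ℝ x y = (1 / 36 : ℝ) ∨ inner ℝ x y = (-1 / 4 : ℝ))
    (hcent : ∀ y ∈ C, ∑ x ∈ C, inner ℝ x y = 0)
    (hframe : ∀ v : E, ∑ x ∈ C, (inner ℝ x v) ^ 2 = (35 / 12 : ℝ) * ‖v‖ ^ 2) : False := by
  refine no_twoDistance_tightFrame_config C (1 / 36) (-1 / 4) (35 / 12) (by norm_num) hC hval hcent hframe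
    (by rw [hcard]; norm_num) (by rw [← Finset.card_pos, hcard]; norm_num) ?_
  intro m h
  have h2 : (2 * m : ℝ) = 49 := by nlinarith [h]
  have h3 : (2 * m : ℕ) = 49 := by exact_mod_cast h2
  omega

/-- The ghost cell with `N = 430`, `s = 1 / 26`, `b = -3 / 13`, frame constant `c = 5` (forced exclusive-neighbour
count `q* = 750/7`, not an even integer): no centred tight-frame two-distance configuration (T5.md §8 (f)). -/
theorem no_ghost_config_86_26th {E : Type*} [NormedAddCommGroup E] [InnerProductSpace ℝ E] [DecidableEq E]
    (C : Finset E) (hcard : C.card = 430) (hC : ∀ x ∈ C, ‖x‖ = 1)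
    (hval : ∀ x ∈ C, ∀ y ∈ C, x ≠ y → inner ℝ x y = (1 / 26 : ℝ) ∨ inner ℝ x y = (-3 / 13 : ℝ))
    (hcent : ∀ y ∈ C, ∑ x ∈ C, inner ℝ x y = 0)
    (hframe : ∀ v : E, ∑ x ∈ C, (inner ℝ x v) ^ 2 = (5 : ℝ) * ‖v‖ ^ 2) : False := by
  refine no_twoDistance_tightFrame_config C (1 / 26) (-3 / 13) (5) (by norm_num) hC hval hcent hframe
    (by rw [hcard]; norm_num) (by rw [← Finset.card_pos, hcard]; norm_num) ?_
  intro m h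
  have h2 : (7 * m : ℝ) = 375 := by nlinarith [h]
  have h3 : (7 * m : ℕ) = 375 := by exact_mod_cast h2
  omega

/-- The ghost cell with `N = 275`, `s = 1 / 56`, `b = -1 / 4`, frame constant `c = 275 / 112` (forced exclusive-neighbour
count `q* = 121/3`, not an even integer): no centred tight-frame two-distance configuration (T5.md §8 (f)). -/
theorem no_ghost_config_112_56th {E : Type*} [NormedAddCommGroup E] [InnerProductSpace ℝ E] [DecidableEq E]
    (C : Finset E) (hcard : C.card = 275) (hC : ∀ x ∈ C, ‖x‖ = 1)
    (hval : ∀ x ∈ C, ∀ y ∈ C, x ≠ y → inner ℝ x y = (1 / 56 : ℝ) ∨ inner ℝ x y = (-1 / 4 : ℝ))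
    (hcent : ∀ y ∈ C, ∑ x ∈ C, inner ℝ x y = 0)
    (hframe : ∀ v : E, ∑ x ∈ C, (inner ℝ x v) ^ 2 = (275 / 112 : ℝ) * ‖v‖ ^ 2) : False := by
  refine no_twoDistance_tightFrame_config C (1 / 56) (-1 / 4) (275 / 112) (by norm_num) hC hval hcent hframe
    (by rw [hcard]; norm_num) (by rw [← Finset.card_pos, hcard]; norm_num) ?_
  intro m h
  have h2 : (6 * m : ℝ) = 121 := by nlinarith [h]
  have h3 : (6 * m : ℕ) = 121 := by exact_mod_cast h2
  omega

/-- The ghost cell with `N = 343`, `s = 1 / 50`, `b = -9 / 40`, frame constant `c = 343 / 125` (forced exclusive-neighbour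
count `q* = 288/5`, not an even integer): no centred tight-frame two-distance configuration (T5.md §8 (f)). -/
theorem no_ghost_config_125_50th {E : Type*} [NormedAddCommGroup E] [InnerProductSpace ℝ E] [DecidableEq E]
    (C : Finset E) (hcard : C.card = 343) (hC : ∀ x ∈ C, ‖x‖ = 1)
    (hval : ∀ x ∈ C, ∀ y ∈ C, x ≠ y → inner ℝ x y = (1 / 50 : ℝ) ∨ inner ℝ x y = (-9 / 40 : ℝ))
    (hcent : ∀ y ∈ C, ∑ x ∈ C, inner ℝ x y = 0)
    (hframe : ∀ v : E, ∑ x ∈ C, (inner ℝ x v) ^ 2 = (343 / 125 : ℝ) * ‖v‖ ^ 2) : False := by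
  refine no_twoDistance_tightFrame_config C (1 / 50) (-9 / 40) (343 / 125) (by norm_num) hC hval hcent hframe
    (by rw [hcard]; norm_num) (by rw [← Finset.card_pos, hcard]; norm_num) ?_
  intro m h
  have h2 : (5 * m : ℝ) = 144 := by nlinarith [h]
  have h3 : (5 * m : ℕ) = 144 := by exact_mod_cast h2
  omega

end Summit.Ventures.PackingBounds.SphericalCodes

end
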